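import Summits.QuantumFields.BalabanUV.Beta.D1BFx.GhostTadpoleRest
import Summits.QuantumFields.BalabanUV.Beta.D1BFx.GhostNeedleRootedLetters

/-!
# `BalabanUV.Beta.D1BFx.NeedleGhostTadpoleRow` — road «BF-x» for binder row D1, slot (K), END row `hGrp gN` (NEEDLES ∪ G_R), (N-2) «NT-7»:
# **THE COMPLETED GHOST TADPOLE ROW `h₇` OF `NeedleRowGlue.abs_gN_row_le_of_tables` (p255957) BY COUNT × SUP** — for `w ≠ 0` the bond-diagonal
# kinetic contact drops and the word is `½·(−x₀cQn⁴)·tadpole (Ggh) (qA_{μ,b+w} ⊙ qA_{ν,b})`; an entry-bounded leg against a kernel supported on ONE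
# block gives `|T₇(b+w,b)| ≤ 4·|x₀cQ|·n⁴∕min 2 a` (sharp jet `n⁻⁴` × needle count), the word is supported in `‖w‖∞ ≤ n − 1`, whence
# `|row₇(n)| ≤ |ωgh|·n⁻⁸·(2(n−1)+1)⁴·(n−1)²·4|x₀cQ|n⁴∕min 2 a` and `h₇` under the displayed scaling `|ωgh n·x₀ n·cQ n|·n² ≤ k` (tolerance `n⁻²`)

HONEST DEPENDENCY (cell records, verbatim): «continuum YM on T⁴ ⇐ BetaPertH ∧ nine spine estimates (0/9 proved); BetaPertH ⇐ (D1) ∧ (D4) ∧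
CAP+tail; G-an2-4 gates asym, D1 and NE2/3/4.»  HONEST FRAMING (cell contract, verbatim): «discharging `BetaPertH` makes Bałaban's UV stability
UNCONDITIONAL — a real constructive-QFT result; it is NOT the continuum limit and NOT the Clay problem.»  THIS MODULE DISCHARGES NOTHING of the wall:
it is [folklore] finite bookkeeping BY NAME over `GhostTadpoleRest` (`WghAt_eq_zero_of_far`), `GhostAveragingSquare` (`WghAt_eq`, `qSqAt_apply`),
`GhostNeedleRootedLetters` (M1 `abs_qAntiAt_le`, count × sup `sum_B_sum_B_abs_qAntiAt_le`), `GhostLeg.bdd_Ggh`, leaf A6 `ContactCount`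
(`abs_fullSum_weighted_le_of_support`, `exists_tendsto_psum_weighted_of_support`, `abs_sum_mul_le_of_convex`), `TadpoleRest.baseKer_tadpoleTableA_eq_zero_of_far`,
the owner's `Assembly` (`sum_uniform_resSite`), `KernelReflection.tadpole_smul`.  The weights `ωgh`, `x₀`, `cK`, `cQ` are ARBITRARY sequences: nothing
about Bałaban's operators is asserted; the scaling letter is DISPLAYED, ruled nowhere here.  No `def`, no `def … : Prop`, nothing cited, 0 sorry.
Root-level binders hW ∕ hR-sockets ∕ hSX-socket ∕ D1Tel ∕ D1Rep — 0 discharged; (K) NOT closed; NOT D1, NOT `BetaPertH`, NOT continuum, NOT Clay.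

ABSOLUTE RULE (cell charter, verbatim): «No internally-minted statement may enter as a cited fact. Every hypothesis is either kernel-proved in this
package or a verbatim quotation of a PUBLISHED theorem with page reference. The manuscript(s) under audit are NOT citable for their own disputed
steps — they are the thing under adjudication; programme-internal (2001/route/tribunal) claims are never citable.»

WHY (owner d1-p2-g9 «NEEDLE-GLUE» p255957, journal l.29099 «(N-2) = prove `h₁…h₈`»; an3-g56 (N-1) memo 7fa163ef7e91e99e §4 T7 «kinetic part LOCAL;
needle part `−x₀ cQ n⁴ • qSqAt` = pointwise square, sup `4|x₀ cQ|·n⁻⁴` per entry with M1, support two needles in one block — count × sup bookkeeping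
only, no overlap sum»; (V4): the `BiLoc`-at-rate-`δ∕n` socket of `GhostTadpoleRest` costs `Zl 4 (δ∕n)² ∼ n⁸` — NOT taken here).

CONTENT (all [folklore]).
* §1 generic: `tadpole_eq_sum_of_support`, **`abs_tadpole_le_of_support`** (leg `|A| ≤ C₀`, kernel vanishing unless both sites lie in a finite set `S`:
  `|tadpole A V| ≤ C₀·Σ_{x ∈ S}Σ_aΣ_{y ∈ S}Σ_f |V y x f a|`).
* §2 the averaging square on its block: `qAntiAt_eq_zero_of_blk_ne_left∕right`, `qSqAt_eq_zero_of_not_mem_left∕right`,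
  **`sum_B_sum_B_abs_qSqAt_le`** (`Σ_{x,y ∈ B(blk u′)} |qSqAt ρ n κ u l u′ y x| ≤ 2n⁻⁴·(2·(n⁴·(n^{l+1}·n⁻⁴)))`), **`abs_tadpole_Ggh_qSqAt_le`**.
* §3 the row: `WghAt_offDiag` (for `u ≠ u′` the table IS `(−x₀cQn⁴)•qSqAt`), **`abs_T₇_le`** (`w ≠ 0`: `|tadpoleTableA (Ggh n a) (WghAt ρ n x₀ cK cQ) μ ν (b+w) b| ≤
  4·|x₀cQ|·n⁴∕min 2 a`), `conv_row₇`, **`abs_fullSum_T₇_le`**, **`abs_row₇_le`**, and in the glue's currency **`h₇_of_countSup`**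
  (`|ωgh n·(x₀ n·cQ n)|·n² ≤ k` ⊢ `h₇` with `C₇ := 64·k∕min 2 a`).
Unit `b2b-balaban-beta-d1-formalise-leaf-04` (gen 8), D1 formalisation swarm; `LEAVES-BFx.md` row (N) ∕ (N-2) «NT-7».
-/

noncomputable section

namespace Summit.QuantumFields.BalabanUV.Beta.D1BFx.NeedleGhostTadpoleRow

open Finset Filter Topology
open scoped BigOperators
open Literature.MathematicalPhysics.QuantumFieldTheory.Balaban1983to89
open Literature.MathematicalPhysics.QuantumFieldTheory.Balaban1983to89.Beta
open B6QGQLower276 (blk B mem_B)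
open ExpKernelCalculus (Site MKer tadpole tr comp)
open Literature.Probability.LatticeModels (annulus)
open DyadicShell (Pt toReal supNorm mem_annulus_iff supNorm_eq_zero_iff)
open WindowIdentification (psum fullSum)
open DressedMomentNormalisation (resSite)
open KernelWard (Bdd)
open KernelReflection (tadpole_smul)
open Summit.QuantumFields.BalabanUV.Beta.D1BFx.MomentTransferPeriodic (baseKer)
open Summit.QuantumFields.BalabanUV.Beta.D1BFx.ReducedKernelSandwichBlock (diagExt diagExt_apply)
open Summit.QuantumFields.BalabanUV.Beta.D1BFx.DressedTablesLeg (tadpoleTableA tadpoleTableA_apply)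
open Summit.QuantumFields.BalabanUV.Beta.D1BFx.ContactCount (abs_sum_mul_le_of_convex abs_fullSum_weighted_le_of_support
  exists_tendsto_psum_weighted_of_support)
open Summit.QuantumFields.BalabanUV.Beta.D1BFx.Assembly (sum_uniform_resSite uniform_resSite_nonneg)
open Summit.QuantumFields.BalabanUV.Beta.D1BFx.GhostLeg (Ggh bdd_Ggh)
open Summit.QuantumFields.BalabanUV.Beta.D1BFx.GhostStencilRooted (qJetAt qAntiAt qAntiAt_apply qJetAt_eq_zero)
open Summit.QuantumFields.BalabanUV.Beta.D1BFx.GhostStencilReflection (ghX)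
open Summit.QuantumFields.BalabanUV.Beta.D1BFx.GhostStencilRootedReflection (ctrHalf)
open Summit.QuantumFields.BalabanUV.Beta.D1BFx.GhostAveragingSquare (qSqAt qSqAt_apply WghAt WghAt_eq)
open Summit.QuantumFields.BalabanUV.Beta.D1BFx.TadpoleRest (baseKer_tadpoleTableA_eq_zero_of_far)
open Summit.QuantumFields.BalabanUV.Beta.D1BFx.GhostTadpoleRest (WghAt_eq_zero_of_far)
open Summit.QuantumFields.BalabanUV.Beta.D1BFx.GhostNeedleRootedLetters (abs_qAntiAt_le sum_B_sum_B_abs_qAntiAt_le)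

/-! ## §1 A tadpole against a finitely supported kernel is a finite sum: count × sup -/

section Generic

variable {D : ℕ} {F : Type*} [Fintype F] {A V : MKer D F} {C₀ : ℝ}

/-- [folklore] **A TADPOLE AGAINST A FINITELY SUPPORTED KERNEL IS A FINITE SUM**: if `V y x f a = 0` unless `y ∈ S` and `x ∈ S`, then
`tadpole A V = Σ_{x ∈ S} Σ_a Σ_{y ∈ S} Σ_f A x y a f · V y x f a` (both series of `tr ∘ comp` reduce to `S`, `tsum_eq_sum`). -/
theorem tadpole_eq_sum_of_support (S : Finset (Site D)) (hl : ∀ y, y ∉ S → ∀ x f a, V y x f a = 0)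
    (hr : ∀ x, x ∉ S → ∀ y f a, V y x f a = 0) :
    tadpole A V = ∑ x ∈ S, ∑ a, ∑ y ∈ S, ∑ f, A x y a f * V y x f a := by
  unfold ExpKernelCalculus.tadpole ExpKernelCalculus.tr ExpKernelCalculus.comp
  rw [tsum_eq_sum (s := S)]
  · refine Finset.sum_congr rfl fun x _ => Finset.sum_congr rfl fun a _ => ?_
    exact tsum_eq_sum (s := S) fun y hy => by simp [hl y hy]
  · intro x hx
    simp [hr x hx]

/-- [folklore] **COUNT × SUP**: an entry-bounded leg (`|A x y a b| ≤ C₀`, `C₀ ≥ 0`) against a kernel supported on `S × S` gives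
`|tadpole A V| ≤ C₀ · Σ_{x ∈ S} Σ_a Σ_{y ∈ S} Σ_f |V y x f a|` — no decay of the leg, no localisation rate of the kernel (and no sign condition on `C₀`). -/
theorem abs_tadpole_le_of_support (S : Finset (Site D)) (hA : ∀ x y a b, |A x y a b| ≤ C₀)
    (hl : ∀ y, y ∉ S → ∀ x f a, V y x f a = 0) (hr : ∀ x, x ∉ S → ∀ y f a, V y x f a = 0) :
    |tadpole A V| ≤ C₀ * ∑ x ∈ S, ∑ a, ∑ y ∈ S, ∑ f, |V y x f a| := by
  rw [tadpole_eq_sum_of_support S hl hr]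
  calc |∑ x ∈ S, ∑ a, ∑ y ∈ S, ∑ f, A x y a f * V y x f a|
      ≤ ∑ x ∈ S, |∑ a, ∑ y ∈ S, ∑ f, A x y a f * V y x f a| := Finset.abs_sum_le_sum_abs _ _
    _ ≤ ∑ x ∈ S, ∑ a, |∑ y ∈ S, ∑ f, A x y a f * V y x f a| := Finset.sum_le_sum fun x _ => Finset.abs_sum_le_sum_abs _ _
    _ ≤ ∑ x ∈ S, ∑ a, ∑ y ∈ S, |∑ f, A x y a f * V y x f a| :=
        Finset.sum_le_sum fun x _ => Finset.sum_le_sum fun a _ => Finset.abs_sum_le_sum_abs _ _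
    _ ≤ ∑ x ∈ S, ∑ a, ∑ y ∈ S, ∑ f, |A x y a f * V y x f a| :=
        Finset.sum_le_sum fun x _ => Finset.sum_le_sum fun a _ => Finset.sum_le_sum fun y _ => Finset.abs_sum_le_sum_abs _ _
    _ ≤ ∑ x ∈ S, ∑ a, ∑ y ∈ S, ∑ f, C₀ * |V y x f a| := by
        refine Finset.sum_le_sum fun x _ => Finset.sum_le_sum fun a _ => Finset.sum_le_sum fun y _ => Finset.sum_le_sum fun f _ => ?_
        rw [abs_mul]
        exact mul_le_mul_of_nonneg_right (hA x y a f) (abs_nonneg _)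
    _ = C₀ * ∑ x ∈ S, ∑ a, ∑ y ∈ S, ∑ f, |V y x f a| := by simp only [Finset.mul_sum]

end Generic

/-! ## §2 The averaging square on its block -/

section Square

variable (ρ : Site 4) (n : ℕ) [NeZero n] (κ : Fin 4) (u : Site 4) (l : Fin 4) (u' : Site 4)

omit [NeZero n] in
/-- [folklore] The rooted stripped jet vanishes unless its FIRST fine site lies in the block of its bond. -/
theorem qAntiAt_eq_zero_of_blk_ne_left {x : Site 4} (h : blk (n - 1) x ≠ blk (n - 1) u) (z : Site 4) (a b : Unit) :
    qAntiAt ρ n κ u x z a b = 0 := by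
  rw [qAntiAt_apply, qJetAt_eq_zero ρ n κ u (fun hh => h hh.2.symm),
    qJetAt_eq_zero ρ n κ u (fun hh => h (hh.1.trans hh.2.symm)), sub_zero]

omit [NeZero n] in
/-- [folklore] … and unless its SECOND fine site lies in the block of its bond. -/
theorem qAntiAt_eq_zero_of_blk_ne_right (x : Site 4) {z : Site 4} (h : blk (n - 1) z ≠ blk (n - 1) u) (a b : Unit) :
    qAntiAt ρ n κ u x z a b = 0 := by
  rw [qAntiAt_apply, qJetAt_eq_zero ρ n κ u (fun hh => h (hh.1.trans hh.2.symm)),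
    qJetAt_eq_zero ρ n κ u (fun hh => h hh.2.symm), sub_zero]

omit [NeZero n] in
/-- [folklore] The averaging square `qSqAt ρ n κ u l u′` is supported on `B(blk u′) × B(blk u′)` — first site. -/
theorem qSqAt_eq_zero_of_not_mem_left (y : Site 4) (hy : y ∉ B (n - 1) (blk (n - 1) u')) (x : Site 4) (f a : Unit) :
    qSqAt ρ n κ u l u' y x f a = 0 := by
  have h : blk (n - 1) y ≠ blk (n - 1) u' := fun e => hy (mem_B.2 e)
  rw [qSqAt_apply, qAntiAt_eq_zero_of_blk_ne_left ρ n l u' h, mul_zero]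

omit [NeZero n] in
/-- [folklore] … — second site. -/
theorem qSqAt_eq_zero_of_not_mem_right (x : Site 4) (hx : x ∉ B (n - 1) (blk (n - 1) u')) (y : Site 4) (f a : Unit) :
    qSqAt ρ n κ u l u' y x f a = 0 := by
  have h : blk (n - 1) x ≠ blk (n - 1) u' := fun e => hx (mem_B.2 e)
  rw [qSqAt_apply, qAntiAt_eq_zero_of_blk_ne_right ρ n l u' y h, mul_zero]

/-- [folklore] **THE BLOCK DOUBLE SUM OF THE AVERAGING SQUARE**: `Σ_{x,y ∈ B(blk u′)} |qSqAt ρ n κ u l u′ y x| ≤ 2n⁻⁴·(2·(n⁴·(n^{l+1}·n⁻⁴)))` — the first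
stripped jet by its sharp sup (M1, `GhostNeedleRootedLetters.abs_qAntiAt_le`), the second by count × sup on the block (`sum_B_sum_B_abs_qAntiAt_le`). -/
theorem sum_B_sum_B_abs_qSqAt_le :
    ∑ x ∈ B (n - 1) (blk (n - 1) u'), ∑ a : Unit, ∑ y ∈ B (n - 1) (blk (n - 1) u'), ∑ f : Unit, |qSqAt ρ n κ u l u' y x f a| ≤
      2 * ((n : ℝ) ^ 4)⁻¹ * (2 * ((n : ℝ) ^ 4 * ((n : ℝ) ^ ((l : ℕ) + 1) * ((n : ℝ) ^ 4)⁻¹))) := by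
  have hterm : ∀ x y : Site 4, ∀ f a : Unit, |qSqAt ρ n κ u l u' y x f a| ≤ 2 * ((n : ℝ) ^ 4)⁻¹ * |qAntiAt ρ n l u' y x f a| := by
    intro x y f a
    rw [qSqAt_apply, abs_mul]
    exact mul_le_mul_of_nonneg_right (abs_qAntiAt_le ρ n κ u y x f a) (abs_nonneg _)
  calc ∑ x ∈ B (n - 1) (blk (n - 1) u'), ∑ a : Unit, ∑ y ∈ B (n - 1) (blk (n - 1) u'), ∑ f : Unit, |qSqAt ρ n κ u l u' y x f a|
      ≤ ∑ x ∈ B (n - 1) (blk (n - 1) u'), ∑ a : Unit, ∑ y ∈ B (n - 1) (blk (n - 1) u'), ∑ f : Unit,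
          2 * ((n : ℝ) ^ 4)⁻¹ * |qAntiAt ρ n l u' y x f a| :=
        Finset.sum_le_sum fun x _ => Finset.sum_le_sum fun a _ => Finset.sum_le_sum fun y _ => Finset.sum_le_sum fun f _ => hterm x y f a
    _ = 2 * ((n : ℝ) ^ 4)⁻¹ * ∑ y ∈ B (n - 1) (blk (n - 1) u'), ∑ x ∈ B (n - 1) (blk (n - 1) u'), |qAntiAt ρ n l u' y x () ()| := by
        simp only [Fintype.sum_unique, PUnit.default_eq_unit, ← Finset.mul_sum]
        rw [Finset.sum_comm]
    _ ≤ 2 * ((n : ℝ) ^ 4)⁻¹ * (2 * ((n : ℝ) ^ 4 * ((n : ℝ) ^ ((l : ℕ) + 1) * ((n : ℝ) ^ 4)⁻¹))) :=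
        mul_le_mul_of_nonneg_left (sum_B_sum_B_abs_qAntiAt_le ρ n l u' (blk (n - 1) u') () ()) (by positivity)

variable {a : ℝ}

/-- [folklore] **THE GHOST TADPOLE OF THE AVERAGING SQUARE, COUNT × SUP**: `|tadpole (Ggh n a) (qSqAt ρ n κ u l u′)| ≤ (2∕min 2 a)·(2n⁻⁴·(2·(n⁴·(n^{l+1}·n⁻⁴))))`
— `GhostLeg.bdd_Ggh` (entry bound FREE of n) against the square supported on one block. -/
theorem abs_tadpole_Ggh_qSqAt_le (ha : 0 < a) :
    |tadpole (Ggh n a) (qSqAt ρ n κ u l u')| ≤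
      2 / min 2 a * (2 * ((n : ℝ) ^ 4)⁻¹ * (2 * ((n : ℝ) ^ 4 * ((n : ℝ) ^ ((l : ℕ) + 1) * ((n : ℝ) ^ 4)⁻¹)))) := by
  have hC₀ : (0 : ℝ) ≤ 2 / min 2 a := by
    have : 0 < min 2 a := lt_min (by norm_num) ha
    positivity
  refine (abs_tadpole_le_of_support (B (n - 1) (blk (n - 1) u')) (bdd_Ggh n a ha)
    (fun y hy x f a' => qSqAt_eq_zero_of_not_mem_left ρ n κ u l u' y hy x f a')
    (fun x hx y f a' => qSqAt_eq_zero_of_not_mem_right ρ n κ u l u' x hx y f a')).trans ?_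
  exact mul_le_mul_of_nonneg_left (sum_B_sum_B_abs_qSqAt_le ρ n κ u l u') hC₀

end Square

/-! ## §3 The completed ghost tadpole row: pointwise, full sum, base-point average, `h₇` -/

section Row

variable (ρ : Site 4) (n : ℕ) [NeZero n] {a : ℝ} (x₀ cK cQ : ℝ)

omit [NeZero n] in
/-- [folklore] **OFF THE BOND DIAGONAL THE COMPLETED GHOST TABLE IS THE AVERAGING SQUARE**: for `u ≠ u′`,
`WghAt ρ n x₀ cK cQ κ u l u′ = (−(x₀·cQ·n⁴)) • qSqAt ρ n κ u l u′` (the kinetic contact `diagExt ((x₀cK)•ghX)` is bond-diagonal). -/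
theorem WghAt_offDiag (κ : Fin 4) {u : Site 4} (l : Fin 4) {u' : Site 4} (h : u ≠ u') :
    WghAt ρ n x₀ cK cQ κ u l u' = (-(x₀ * cQ * (n : ℝ) ^ 4)) • qSqAt ρ n κ u l u' := by
  have hne : ¬(κ = l ∧ u = u') := fun hh => h hh.2
  funext x z a b
  simp only [WghAt_eq, Pi.add_apply, Pi.smul_apply, diagExt_apply, hne, if_false, zero_add]

/-- [folklore] **THE COMPLETED GHOST TADPOLE WORD AT A NON-ZERO DISPLACEMENT, COUNT × SUP**: for `w ≠ 0`, `0 < a`, every root `ρ` and all weights,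
`|tadpoleTableA (Ggh n a) (WghAt ρ n x₀ cK cQ) μ ν (b + w) b| ≤ 4·|x₀·cQ|·n⁴ ∕ min 2 a` — the weight `x₀cQn⁴` × leg sup `2∕min 2 a` × first jet `2n⁻⁴` ×
`(n⁴ sites) × (needle mass n^{ν+1}·n⁻⁴ ≤ 1)`; the kinetic weight `cK` does not enter. -/
theorem abs_T₇_le (ha : 0 < a) (μ ν : Fin 4) (b : Pt) {w : Pt} (hw : w ≠ 0) :
    |tadpoleTableA (Ggh n a) (WghAt ρ n x₀ cK cQ) μ ν (b + w) b| ≤ 4 * |x₀ * cQ| * (n : ℝ) ^ 4 / min 2 a := by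
  have hn1 : (1 : ℝ) ≤ n := by exact_mod_cast NeZero.one_le
  have hn : (0 : ℝ) < n := by linarith
  have hm : 0 < min 2 a := lt_min (by norm_num) ha
  have hbw : b + w ≠ b := fun e => hw (by simpa using e)
  rw [tadpoleTableA_apply, WghAt_offDiag ρ n x₀ cK cQ μ ν hbw, tadpole_smul, abs_mul, abs_mul,
    abs_of_pos (by norm_num : (0 : ℝ) < 1 / 2)]
  have hT := abs_tadpole_Ggh_qSqAt_le ρ n μ (b + w) ν b ha
  -- the needle mass `n^{ν+1}·n⁻⁴ ≤ 1`
  have hν : (n : ℝ) ^ ((ν : ℕ) + 1) * ((n : ℝ) ^ 4)⁻¹ ≤ 1 := by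
    rw [← div_eq_mul_inv, div_le_one (pow_pos hn 4)]
    exact pow_le_pow_right₀ hn1 (by have := ν.isLt; omega)
  have hT' : |tadpole (Ggh n a) (qSqAt ρ n μ (b + w) ν b)| ≤ 2 / min 2 a * (2 * ((n : ℝ) ^ 4)⁻¹ * (2 * ((n : ℝ) ^ 4 * 1))) := by
    refine hT.trans (mul_le_mul_of_nonneg_left ?_ (by positivity))
    exact mul_le_mul_of_nonneg_left (mul_le_mul_of_nonneg_left (mul_le_mul_of_nonneg_left hν (by positivity)) (by norm_num))
      (by positivity)
  have hc : |(-(x₀ * cQ * (n : ℝ) ^ 4))| = |x₀ * cQ| * (n : ℝ) ^ 4 := by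
    rw [abs_neg, abs_mul, abs_of_pos (pow_pos hn 4)]
  rw [hc]
  calc 1 / 2 * (|x₀ * cQ| * (n : ℝ) ^ 4 * |tadpole (Ggh n a) (qSqAt ρ n μ (b + w) ν b)|)
      ≤ 1 / 2 * (|x₀ * cQ| * (n : ℝ) ^ 4 * (2 / min 2 a * (2 * ((n : ℝ) ^ 4)⁻¹ * (2 * ((n : ℝ) ^ 4 * 1))))) :=
        mul_le_mul_of_nonneg_left (mul_le_mul_of_nonneg_left hT' (by positivity)) (by norm_num)
    _ = 4 * |x₀ * cQ| * (n : ℝ) ^ 4 / min 2 a := by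
        field_simp
        ring

/-- [folklore] The word is finitely supported in the displacement (radius `n − 1`: the table sees one block, `GhostTadpoleRest.WghAt_eq_zero_of_far`). -/
theorem T₇_eq_zero_of_far (μ ν : Fin 4) (b w : Pt) (hw : n - 1 < supNorm w) :
    tadpoleTableA (Ggh n a) (WghAt ρ n x₀ cK cQ) μ ν (b + w) b = 0 :=
  baseKer_tadpoleTableA_eq_zero_of_far (A := Ggh n a) (fun κ u l u' hfar => WghAt_eq_zero_of_far n ρ x₀ cK cQ κ u l u' hfar) μ ν b w hw

/-- [folklore] (CONV) of the row integrand at every base site — unconditional (finite support). -/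
theorem conv_row₇ (μ ν : Fin 4) (b : Pt) :
    ∃ L, Tendsto (psum (fun w : Pt => toReal w μ * toReal w ν * tadpoleTableA (Ggh n a) (WghAt ρ n x₀ cK cQ) μ ν (b + w) b)) atTop (𝓝 L) :=
  exists_tendsto_psum_weighted_of_support (fun w hw => T₇_eq_zero_of_far ρ n x₀ cK cQ μ ν b w hw) μ ν

/-- [folklore] **THE WEIGHTED FULL SUM OF THE COMPLETED GHOST TADPOLE WORD AT A BASE SITE**:
`|fullSum (w ↦ w_μ w_ν · T₇(b+w, b))| ≤ (2(n−1)+1)⁴·((n−1)²·(4·|x₀cQ|·n⁴∕min 2 a))` — finite support × the (1.22)-weight on the ball × `abs_T₇_le`. -/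
theorem abs_fullSum_T₇_le (ha : 0 < a) (μ ν : Fin 4) (b : Pt) :
    |fullSum (fun w : Pt => toReal w μ * toReal w ν * tadpoleTableA (Ggh n a) (WghAt ρ n x₀ cK cQ) μ ν (b + w) b)| ≤
      (2 * ((n - 1 : ℕ) : ℝ) + 1) ^ 4 * ((((n - 1 : ℕ) : ℝ)) ^ 2 * (4 * |x₀ * cQ| * (n : ℝ) ^ 4 / min 2 a)) := by
  have hm : 0 < min 2 a := lt_min (by norm_num) ha
  refine abs_fullSum_weighted_le_of_support (by positivity) (fun w hw => T₇_eq_zero_of_far ρ n x₀ cK cQ μ ν b w hw) (fun w hw => ?_) μ ν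
  have hw0 : w ≠ 0 := fun e => by
    have h1 := (mem_annulus_iff.mp hw).1
    rw [e, supNorm_eq_zero_iff.mpr rfl] at h1
    exact lt_irrefl _ h1
  exact abs_T₇_le ρ n x₀ cK cQ ha μ ν b hw0

/-- [folklore] **THE COMPLETED GHOST TADPOLE ROW AT FIXED `n`, BASE-POINT AVERAGED, WITH ITS WEIGHT**:
`|ωgh · Σ_{b ∈ image resSite} n⁻⁴·(n⁻⁸·fullSum (…))| ≤ |ωgh|·(n⁻⁸·((2(n−1)+1)⁴·((n−1)²·(4·|x₀cQ|·n⁴∕min 2 a))))`. -/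
theorem abs_row₇_le (ha : 0 < a) (ωgh : ℝ) (μ ν : Fin 4) :
    |ωgh * ∑ b ∈ (univ : Finset (Fin 4 → Fin n)).image resSite, ((n : ℝ) ^ 4)⁻¹ * (((n : ℝ) ^ 8)⁻¹ *
        fullSum (fun w : Pt => toReal w μ * toReal w ν * tadpoleTableA (Ggh n a) (WghAt ρ n x₀ cK cQ) μ ν (b + w) b))| ≤
      |ωgh| * (((n : ℝ) ^ 8)⁻¹ * ((2 * ((n - 1 : ℕ) : ℝ) + 1) ^ 4 * ((((n - 1 : ℕ) : ℝ)) ^ 2 * (4 * |x₀ * cQ| * (n : ℝ) ^ 4 / min 2 a)))) := by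
  have hm : 0 < min 2 a := lt_min (by norm_num) ha
  rw [abs_mul]
  refine mul_le_mul_of_nonneg_left ?_ (abs_nonneg ωgh)
  refine abs_sum_mul_le_of_convex _ (fun b hb => uniform_resSite_nonneg n b hb) (sum_uniform_resSite (NeZero.ne n)) fun b _ => ?_
  rw [abs_mul, abs_of_nonneg (by positivity : (0 : ℝ) ≤ ((n : ℝ) ^ 8)⁻¹)]
  exact mul_le_mul_of_nonneg_left (abs_fullSum_T₇_le ρ n x₀ cK cQ ha μ ν b) (by positivity)

end Row

/-! ## §3′ In the glue's currency: `h₇` under the displayed scaling letter -/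

section Glue

variable {a : ℝ} {x₀ cK cQ ωgh : ℕ → ℝ} {k : ℝ}

/-- [folklore] Arithmetic of the block-size powers: `n⁻⁸·(2(n−1)+1)⁴·(n−1)²·n⁴ ≤ 16·n²` (`n ≥ 1`). -/
theorem pow_bookkeeping (n : ℕ) (hn : 1 ≤ n) :
    ((n : ℝ) ^ 8)⁻¹ * ((2 * ((n - 1 : ℕ) : ℝ) + 1) ^ 4 * ((((n - 1 : ℕ) : ℝ)) ^ 2 * (n : ℝ) ^ 4)) ≤ 16 * (n : ℝ) ^ 2 := by
  have hn' : (1 : ℝ) ≤ n := by exact_mod_cast hn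
  have hpos : (0 : ℝ) < n := by linarith
  have e : ((n - 1 : ℕ) : ℝ) = (n : ℝ) - 1 := by rw [Nat.cast_sub hn, Nat.cast_one]
  rw [e]
  have h1 : (2 * ((n : ℝ) - 1) + 1) ^ 4 ≤ (2 * (n : ℝ)) ^ 4 :=
    pow_le_pow_left₀ (by linarith) (by linarith) 4
  have h2 : ((n : ℝ) - 1) ^ 2 ≤ (n : ℝ) ^ 2 := pow_le_pow_left₀ (by linarith) (by linarith) 2
  calc ((n : ℝ) ^ 8)⁻¹ * ((2 * ((n : ℝ) - 1) + 1) ^ 4 * (((n : ℝ) - 1) ^ 2 * (n : ℝ) ^ 4))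
      ≤ ((n : ℝ) ^ 8)⁻¹ * ((2 * (n : ℝ)) ^ 4 * ((n : ℝ) ^ 2 * (n : ℝ) ^ 4)) := by
        gcongr
    _ = 16 * (n : ℝ) ^ 2 := by field_simp; ring

/-- [folklore] **«NT-7»: THE COMPLETED GHOST TADPOLE ROW `h₇` OF THE NEEDLE GROUP, BY COUNT × SUP** — displayed: `0 < a` and ONE scaling letter on the
weights, `|ωgh n · (x₀ n · cQ n)| · n² ≤ k` for `n ≥ 2` (slot (K)'s units; ruled nowhere here).  Output = `h₇` of `NeedleRowGlue.abs_gN_row_le_of_tables`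
VERBATIM with `C₇ := 64·k ∕ min 2 a`.  The kinetic weight `cK` is unconstrained (its contact is bond-diagonal and carries the (1.22)-weight `0`). -/
theorem h₇_of_countSup (ha : 0 < a) (hk : ∀ n : ℕ, 2 ≤ n → |ωgh n * (x₀ n * cQ n)| * (n : ℝ) ^ 2 ≤ k) (μ ν : Fin 4) :
    ∀ n : ℕ, 2 ≤ n → ∀ [NeZero n], |ωgh n * ∑ b ∈ (univ : Finset (Fin 4 → Fin n)).image resSite, ((n : ℝ) ^ 4)⁻¹ * (((n : ℝ) ^ 8)⁻¹ *
      fullSum (fun w : Pt => toReal w μ * toReal w ν *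
        tadpoleTableA (Ggh n a) (WghAt (ctrHalf n) n (x₀ n) (cK n) (cQ n)) μ ν (b + w) b))| ≤ 64 * k / min 2 a := by
  intro n hn _
  have hm : 0 < min 2 a := lt_min (by norm_num) ha
  have h1 : 1 ≤ n := le_trans (by norm_num) hn
  refine (abs_row₇_le (ctrHalf n) n (x₀ n) (cK n) (cQ n) ha (ωgh n) μ ν).trans ?_
  have hpb := pow_bookkeeping n h1
  have hkk := hk n hn
  have hx : 0 ≤ |x₀ n * cQ n| := abs_nonneg _
  -- regroup the right-hand side as `(|ωgh|·|x₀cQ|) · [n⁻⁸·(2(n−1)+1)⁴·(n−1)²·n⁴] · (4 ∕ min 2 a)`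
  have e : |ωgh n| * (((n : ℝ) ^ 8)⁻¹ * ((2 * ((n - 1 : ℕ) : ℝ) + 1) ^ 4 *
        ((((n - 1 : ℕ) : ℝ)) ^ 2 * (4 * |x₀ n * cQ n| * (n : ℝ) ^ 4 / min 2 a)))) =
      (|ωgh n| * |x₀ n * cQ n|) * (((n : ℝ) ^ 8)⁻¹ * ((2 * ((n - 1 : ℕ) : ℝ) + 1) ^ 4 * ((((n - 1 : ℕ) : ℝ)) ^ 2 * (n : ℝ) ^ 4))) *
        (4 / min 2 a) := by
    field_simp
  rw [e]
  have hω : |ωgh n| * |x₀ n * cQ n| = |ωgh n * (x₀ n * cQ n)| := (abs_mul _ _).symm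
  rw [hω]
  calc |ωgh n * (x₀ n * cQ n)| * (((n : ℝ) ^ 8)⁻¹ * ((2 * ((n - 1 : ℕ) : ℝ) + 1) ^ 4 * ((((n - 1 : ℕ) : ℝ)) ^ 2 * (n : ℝ) ^ 4))) *
        (4 / min 2 a)
      ≤ |ωgh n * (x₀ n * cQ n)| * (16 * (n : ℝ) ^ 2) * (4 / min 2 a) := by
        gcongr
    _ = (|ωgh n * (x₀ n * cQ n)| * (n : ℝ) ^ 2) * (64 / min 2 a) := by ring
    _ ≤ k * (64 / min 2 a) := mul_le_mul_of_nonneg_right hkk (by positivity)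
    _ = 64 * k / min 2 a := by ring

end Glue

end Summit.QuantumFields.BalabanUV.Beta.D1BFx.NeedleGhostTadpoleRow

end
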